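/-
Copyright (c) 2026 the pub-hodgecm-mathlib formalisation cell (harness21).  Prover seat hodgecm-mathlib-K2E3-p11 (g2), Track B «K2-LIT» ∕ h413,
unit U12 «Characters» of the line `K2_E3_EllipticInputs`, socket #11 `sig_K2E3CharLocIntNearSemisimple`: the socket in the ORGAN'S RANKS `N ≤ 3` (⚑1) from
two analytic letters only — the identity case (11-Id) and the descent at the TYPE-(2,1) points of `U_3` — plus socket U12-a; admissibility and all the case
analysis are ★.  2026-09-04.
-/
import Summits.HodgeConjecture.HodgeConjecture.Theorems.K2E3CharLocIntNearSemisimpleOfIdentityDescent   -- ★ p855869 (this seat): composition; brings ★ p855802 (N = 2, central translation), ★ p855012 §5 (regular points)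
import Summits.HodgeConjecture.HodgeConjecture.Theorems.K2E3SemisimpleSingularThreeClassification     -- ★ p855854 (this seat): `isRegularElt_or_mem_center_or_type21`
import Summits.HodgeConjecture.HodgeConjecture.Theorems.K2E3CharLocIntNearSemisimpleLeOne              -- ★ p855722 (this seat): `charLocIntNear_of_le_one`
import Summits.HodgeConjecture.HodgeConjecture.Theorems.K2E3LocalIrrepAdmissibleLeThree                -- ★ p855226 (K2E3-p11 g0): `localIrrepAdmissible_of_le_three`
import HarnessLib

/-!
# K2_E3 road (h413 = stmt-HodgeConjecture-24833), unit U12 «Characters», socket #11 `sig_K2E3CharLocIntNearSemisimple` FOR `N ≤ 3`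
# ⟸ (U12-a) + (11-Id: the identity) + (11-D₂₁: descent at the type-(2,1) points of `U_3`), sorry-free — the organ's ranks (⚑1: `hHC` is instantiated at `N = 2, 3`)

Cell `pub/hodgecm-mathlib` (D-0151), Track B (21-frontier RULING «PUSH BOTH» 2026-09-03), socket module
`Summits/HodgeConjecture/HodgeConjecture/Cruxes/H413/Lines/K2_E3_EllipticInputsSigs_U12Characters.lean` (ED. 5), socket **`sig_K2E3CharLocIntNearSemisimple`**
(SIGS-TABLE-K2E3 row #11, XL).  `--supports stmt-HodgeConjecture-24833 --as helper`; theorems only — no `def`, no named fact, no instance, no notation, no `sorry`.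

WHAT.  ★ p855869 composes the socket (every `N`) from U12-g + U12-a + (11-Id) + (11-D).  In the ranks the organ uses, two of the four inputs are ★ or sharpen:
U12-g (admissibility) is ★ for `N ≤ 3` (`localIrrepAdmissible_of_le_three`, p855226), and (11-D) «the conclusion at non-regular non-central semisimple points» is
VACUOUS for `N ≤ 2` (★ p855802) and at `N = 3` concerns only the TYPE-(2,1) points (★ p855854 `isRegularElt_or_mem_center_or_type21`: `minpoly(s_{w₀}) =
(X − λ)(X − μ)`, `charpoly(s_{w₀}) = (X − λ)(X − μ)²`, `λ ≠ μ ∈ L_{w₀}`; there `Z_G(s) ≅ U(2)×U(1)` ∕ `GL₂×GL₁` and Harish-Chandra's descent [HarishChandra1999 §18]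
is a genuine reduction to a smaller group of the same kind).  Hence **`charLocIntNearSemisimple_le_three_of_identity_of_type21`**:
  `‹U12-a› → ‹11-Id› → ‹11-D₂₁› → ∀ L N H, N ≤ 3 → ‹the socket's bytes›`,
with (11-D₂₁) = the socket's conclusion at the type-(2,1) semisimple points of `U_3(H)(L⁺_v)`, the spectral data `(w₀, λ, μ)` GIVEN as hypotheses (so its prover
starts from the eigenvalues in hand).  `N ≤ 1`: ★ p855722 outright (no letter used); `N = 2`: ★ p855869 §2; `N = 3`: trichotomy.  For convenience §1 records that a
type-(2,1) element is NOT regular (`not_isRegularElt_of_type21`), so (11-D₂₁) is literally a special case of (11-D).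

* §1 `not_isRegularElt_of_type21`.
* §2 **`charLocIntNearSemisimple_le_three_of_identity_of_type21`**.

HONEST LABEL: HC_CM is proved only modulo the 7 printed citations (2 remaining named inputs: hLiu418 = stmt-HodgeConjecture-24832, h413 =
stmt-HodgeConjecture-24833) until rung 0 closes; this file is an unconditional `--supports` helper (composition in ranks `≤ 3`); the two analytic letters (11-Id)
[HC1999 Thm 16.1 at `γ = 1`] and (11-D₂₁) [HC1999 §18 + §21 at a type-(2,1) point] and socket U12-a remain the content.

## References
* [HarishChandra1999AdmissibleDistributions] Harish-Chandra (notes by S. DeBacker and P. J. Sally, Jr.), *Admissible Invariant Distributions on Reductive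
  p-adic Groups*, AMS University Lecture Series 16 (1999), Thm. 16.1 p. 77, §18 pp. 78–80, §21 p. 87.
* [Rogawski1990] J. D. Rogawski, *Automorphic Representations of Unitary Groups in Three Variables*, Ann. of Math. Stud. 123 (1990), §1.6 pp. 5–6, §3.1 p. 19,
  §3.5–§3.6, §12.1 (the ranks `2, 3` of the stabilised trace formula).
* [Borel1991] A. Borel, *Linear Algebraic Groups*, 2nd ed., GTM 126 (1991), I.4 (4.2)–(4.4).
-/

set_option autoImplicit false
set_option linter.dupNamespace false

noncomputable section

open MeasureTheory NumberField IsDedekindDomain Topology Polynomial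
open Literature.NumberTheory.Rogawski1990 Literature.NumberTheory.Automorphic
open scoped Matrix MatrixGroups

namespace Summit.HodgeConjecture.HodgeConjecture.Cruxes.H413.K2E3CharLocIntNearSemisimpleLeThreeOfIdentity

/-! ## §1  A type-(2,1) element is not regular -/

open scoped Classical in
/-- If some component `s_{w₀}` of `s ∈ GL_N(Π_w L_w)` has characteristic polynomial `(X − λ)(X − μ)²`, then `s` is NOT regular (that component's characteristic
polynomial has the square factor `(X − μ)²`, so it is not squarefree, hence not separable; regularity is read componentwise, ★ `separable_iff_forall_map_evalRingHom`).
[cite: Rogawski1990, §3.1 p. 19] [cite: Borel1991, I.4 (4.2)–(4.4)] -/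
theorem not_isRegularElt_of_type21 (L : Type) [Field L] [NumberField L] {N : ℕ} (v : HeightOneSpectrum (𝓞 ↥(maximalRealSubfield L)))
    (s : GL (Fin N) (UnitaryGroup.LocalRing L v)) (w₀ : UnitaryGroup.PlacesOver L v) (lam mu : w₀.1.adicCompletion L)
    (hchar : ((s : Matrix (Fin N) (Fin N) (UnitaryGroup.LocalRing L v)).map
      (Pi.evalRingHom (fun w' : UnitaryGroup.PlacesOver L v => w'.1.adicCompletion L) w₀)).charpoly = (X - C lam) * (X - C mu) ^ 2) :
    ¬ IsRegularElt s := by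
  intro hreg
  rw [isRegularElt_iff, Literature.Algebra.Polynomial.separable_iff_forall_map_evalRingHom] at hreg
  have h := hreg w₀
  rw [← Matrix.charpoly_map, hchar] at h
  have hsq : Squarefree ((X - C lam) * (X - C mu) ^ 2) := h.squarefree
  have hunit : IsUnit (X - C mu) := hsq (X - C mu) ⟨X - C lam, by ring⟩
  exact not_isUnit_X_sub_C mu hunit

/-! ## §2  The socket for `N ≤ 3` from U12-a, (11-Id) and (11-D₂₁) -/

set_option maxHeartbeats 1600000 in
open scoped Classical in
/-- **SOCKET #11 FOR `N ≤ 3` FROM (U12-a), (11-Id) AND THE TYPE-(2,1) DESCENT LETTER (11-D₂₁), sorry-free.**  `h9` = socket U12-a's bytes; `hId` = (11-Id): the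
socket's conclusion at `s = 1` (every `N`; used at `N = 2, 3`); `hD21` = (11-D₂₁): the socket's conclusion at every semisimple `s ∈ U_3(H)(L⁺_v)` GIVEN a place
`w₀ ∣ v` and `λ ≠ μ ∈ L_{w₀}` with `minpoly(s_{w₀}) = (X − λ)(X − μ)`, `charpoly(s_{w₀}) = (X − λ)(X − μ)²` [HC1999 §18 + §21: descent to `Z_G(s) ≅ U(2)×U(1)` ∕
`GL₂×GL₁`].  Conclusion: the socket's bytes with the binder `N ≤ 3 →`.  `N ≤ 1` ★ p855722; `N = 2` ★ p855869 §2 (non-regular ⇒ central, ★ p855802); `N = 3`: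
★ p855854 trichotomy — regular ⇒ ★ p855012 §5 from `h9`; central ⇒ ★ p855802 §3 from `hId` (admissible by ★ p855226); type (2,1) ⇒ `hD21`.
[cite: HarishChandra1999, Thm. 16.1 p. 77, §18 pp. 78–80, §21 p. 87] [cite: Rogawski1990, §1.6 pp. 5–6, §3.5–§3.6] -/
theorem charLocIntNearSemisimple_le_three_of_identity_of_type21
    -- (U12-a)
    (h9 : ∀ (L : Type) [Field L] [NumberField L] [IsCMField L] (N : ℕ) (H : Matrix (Fin N) (Fin N) L),
      (H.map (cmConjRingHom L))ᵀ = H → H.det ≠ 0 →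
      ∀ (v : HeightOneSpectrum (𝓞 ↥(maximalRealSubfield L)))
        [MeasurableSpace ((UnitaryGroup.cmDatum L N H).Local v)] [BorelSpace ((UnitaryGroup.cmDatum L N H).Local v)]
        (μ : Measure ((UnitaryGroup.cmDatum L N H).Local v)) [μ.IsHaarMeasure]
        (c : IrrClass ((UnitaryGroup.cmDatum L N H).Local v)),
        ∃ Θ : (UnitaryGroup.cmDatum L N H).Local v → ℂ,
          IsLocallyConstant (fun g : {g : (UnitaryGroup.cmDatum L N H).Local v // IsRegularElt (g.1 : GL (Fin N) (UnitaryGroup.LocalRing L v))} => Θ g.1) ∧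
          ∀ f : (UnitaryGroup.cmDatum L N H).Local v → ℂ, f ∈ SchwartzBruhat ((UnitaryGroup.cmDatum L N H).Local v) →
            tsupport f ⊆ {g : (UnitaryGroup.cmDatum L N H).Local v | IsRegularElt (g.val : GL (Fin N) (UnitaryGroup.LocalRing L v))} →
            c.smoothTrace μ f = ∫ g, f g * Θ g ∂μ)
    -- (11-Id)
    (hId : ∀ (L : Type) [Field L] [NumberField L] [IsCMField L] (N : ℕ) (H : Matrix (Fin N) (Fin N) L),
      (H.map (cmConjRingHom L))ᵀ = H → H.det ≠ 0 →
      ∀ (v : HeightOneSpectrum (𝓞 ↥(maximalRealSubfield L)))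
        [MeasurableSpace ((UnitaryGroup.cmDatum L N H).Local v)] [BorelSpace ((UnitaryGroup.cmDatum L N H).Local v)]
        (μ : Measure ((UnitaryGroup.cmDatum L N H).Local v)) [μ.IsHaarMeasure]
        (c : IrrClass ((UnitaryGroup.cmDatum L N H).Local v)),
        ∃ U : Set ((UnitaryGroup.cmDatum L N H).Local v), IsOpen U ∧ (1 : (UnitaryGroup.cmDatum L N H).Local v) ∈ U ∧
          ∃ Θ : (UnitaryGroup.cmDatum L N H).Local v → ℂ, IntegrableOn Θ U μ ∧
            ∀ f : (UnitaryGroup.cmDatum L N H).Local v → ℂ, f ∈ SchwartzBruhat ((UnitaryGroup.cmDatum L N H).Local v) → tsupport f ⊆ U →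
              c.smoothTrace μ f = ∫ g, f g * Θ g ∂μ)
    -- (11-D₂₁) descent at the type-(2,1) points of `U_3`
    (hD21 : ∀ (L : Type) [Field L] [NumberField L] [IsCMField L] (H : Matrix (Fin 3) (Fin 3) L),
      (H.map (cmConjRingHom L))ᵀ = H → H.det ≠ 0 →
      ∀ (v : HeightOneSpectrum (𝓞 ↥(maximalRealSubfield L)))
        [MeasurableSpace ((UnitaryGroup.cmDatum L 3 H).Local v)] [BorelSpace ((UnitaryGroup.cmDatum L 3 H).Local v)]
        (μ : Measure ((UnitaryGroup.cmDatum L 3 H).Local v)) [μ.IsHaarMeasure]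
        (c : IrrClass ((UnitaryGroup.cmDatum L 3 H).Local v)),
        ∀ s : (UnitaryGroup.cmDatum L 3 H).Local v, Module.End.IsSemisimple (Matrix.toLin' ((s.val : GL (Fin 3) (UnitaryGroup.LocalRing L v)).val : Matrix (Fin 3) (Fin 3) (UnitaryGroup.LocalRing L v))) →
          ∀ (w₀ : UnitaryGroup.PlacesOver L v) (lam mu : w₀.1.adicCompletion L), lam ≠ mu →
            minpoly (w₀.1.adicCompletion L) (((s.val : GL (Fin 3) (UnitaryGroup.LocalRing L v)) : Matrix (Fin 3) (Fin 3) (UnitaryGroup.LocalRing L v)).map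
              (Pi.evalRingHom (fun w' : UnitaryGroup.PlacesOver L v => w'.1.adicCompletion L) w₀)) = (X - C lam) * (X - C mu) →
            (((s.val : GL (Fin 3) (UnitaryGroup.LocalRing L v)) : Matrix (Fin 3) (Fin 3) (UnitaryGroup.LocalRing L v)).map
              (Pi.evalRingHom (fun w' : UnitaryGroup.PlacesOver L v => w'.1.adicCompletion L) w₀)).charpoly = (X - C lam) * (X - C mu) ^ 2 →
          ∃ U : Set ((UnitaryGroup.cmDatum L 3 H).Local v), IsOpen U ∧ s ∈ U ∧
            ∃ Θ : (UnitaryGroup.cmDatum L 3 H).Local v → ℂ, IntegrableOn Θ U μ ∧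
              ∀ f : (UnitaryGroup.cmDatum L 3 H).Local v → ℂ, f ∈ SchwartzBruhat ((UnitaryGroup.cmDatum L 3 H).Local v) → tsupport f ⊆ U →
                c.smoothTrace μ f = ∫ g, f g * Θ g ∂μ) :
    -- the socket for `N ≤ 3`
    ∀ (L : Type) [Field L] [NumberField L] [IsCMField L] (N : ℕ) (H : Matrix (Fin N) (Fin N) L), N ≤ 3 →
      (H.map (cmConjRingHom L))ᵀ = H → H.det ≠ 0 →
      ∀ (v : HeightOneSpectrum (𝓞 ↥(maximalRealSubfield L)))
        [MeasurableSpace ((UnitaryGroup.cmDatum L N H).Local v)] [BorelSpace ((UnitaryGroup.cmDatum L N H).Local v)]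
        (μ : Measure ((UnitaryGroup.cmDatum L N H).Local v)) [μ.IsHaarMeasure]
        (c : IrrClass ((UnitaryGroup.cmDatum L N H).Local v)),
        ∀ s : (UnitaryGroup.cmDatum L N H).Local v, Module.End.IsSemisimple (Matrix.toLin' ((s.val : GL (Fin N) (UnitaryGroup.LocalRing L v)).val : Matrix (Fin N) (Fin N) (UnitaryGroup.LocalRing L v))) →
          ∃ U : Set ((UnitaryGroup.cmDatum L N H).Local v), IsOpen U ∧ s ∈ U ∧
            ∃ Θ : (UnitaryGroup.cmDatum L N H).Local v → ℂ, IntegrableOn Θ U μ ∧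
              ∀ f : (UnitaryGroup.cmDatum L N H).Local v → ℂ, f ∈ SchwartzBruhat ((UnitaryGroup.cmDatum L N H).Local v) → tsupport f ⊆ U →
                c.smoothTrace μ f = ∫ g, f g * Θ g ∂μ := by
  intro L _ _ _ N H hN hH hHd v _ _ μ _ c s hss
  obtain rfl | rfl | rfl | rfl : N = 0 ∨ N = 1 ∨ N = 2 ∨ N = 3 := by omega
  · exact K2E3CharLocIntNearSemisimpleLeOne.charLocIntNear_of_le_one L 0 H v (by norm_num) μ c s
  · exact K2E3CharLocIntNearSemisimpleLeOne.charLocIntNear_of_le_one L 1 H v (by norm_num) μ c s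
  · exact K2E3CharLocIntNearSemisimpleOfIdentityDescent.charLocIntNearSemisimple_two_of_identity' h9 hId L H hH hHd v μ c s hss
  · -- `N = 3`: regular ∕ central ∕ type (2,1)
    rcases K2E3SemisimpleSingularThreeClassification.isRegularElt_or_mem_center_or_type21 L H v hH hHd s hss with hreg | hz | ⟨w₀, lam, mu, hne, hmin, hchar⟩
    · exact K2E3CharLocIntNearSemisimpleFinDim.charLocIntNear_of_locConst_regular L 3 H v μ c (h9 L 3 H hH hHd v μ c) s hreg
    · haveI : NonarchimedeanGroup ((UnitaryGroup.cmDatum L 3 H).Local v) :=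
        UnitaryGroup.nonarchimedeanGroup_unitaryGroupOfForm_local (E := L) (c := IsCMField.complexConj L) (N := 3) (v := v)
          (J' := (UnitaryGroup.adelicForm L 3 H).map (UnitaryGroup.adeleToLocal L v))
      have hadm : c.IsAdmissible :=
        K2E3LocalIrrepAdmissibleLeThree.localIrrepAdmissible_of_le_three L (by norm_num) H hH (isUnit_iff_ne_zero.2 hHd) v c
      induction c using IrrClass.ind with
      | h r =>
        exact K2E3CharLocIntNearSemisimpleTwoOfIdentity.charLocIntNear_of_mem_center_of_one μ r ((IrrClass.isAdmissible_mk r).1 hadm) hz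
          (hId L 3 H hH hHd v μ (IrrClass.mk r))
    · exact hD21 L H hH hHd v μ c s hss w₀ lam mu hne hmin hchar

end Summit.HodgeConjecture.HodgeConjecture.Cruxes.H413.K2E3CharLocIntNearSemisimpleLeThreeOfIdentity

end
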